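import Mathlib
import HarnessLib
import Summits.Ventures.LatticeQCDFlow.Scaling.Acceptance
import Summits.Ventures.LatticeQCDFlow.Scoring.IMHAcceptanceFromWeights

/-!
# LatticeQCDFlow / Scaling — the acceptance DEFICIT is the Gini coefficient of the importance
# weights; two ESS floors for the acceptance: `acc ≥ 1 − √((1/ESS − 1)/2)` and `acc ≥ ESS/2`

HONEST FRAMING: exact (Metropolis-corrected) sampling algorithms for lattice gauge theory;
figures of merit are autocorrelation/cost numbers at stated couplings and volumes; no
continuum-physics claim.

Venture `LatticeQCDFlow` (cell pub-lqcd), topic `Scaling`; FANOUT row 3 (`s0-u1-a`, S0-B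
implementation A, GEN-6).  NEW WORK of the cell (finite-sum algebra and two Cauchy–Schwarz steps
over Mathlib), not a published result; NO definition is introduced.  Vocabulary of record:
`Exactness.accRate` (`Exactness/FlowMCMC`), `Theory2.weight` / `Theory2.essFrac`
(`Scaling/ImportanceWeights`), `tvDist` / `prodLaw`; it USES row 11's
`Scoring.accRate_eq_qq_min_weight` (`acc = E_{q⊗q}[min(w, w′)]`, `Scoring/IMHAcceptanceFromWeights`)
and theory-2's `accRate_eq_one_sub_tvDist_prodLaw` (`acc = 1 − ‖p⊗q − q⊗p‖_TV`,
`Scaling/Acceptance`).  Printed counterparts NAMED ONLY (nothing is cited as a tree fact): the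
Gini index of a positive variable `W` is `G = E|W − W′|/(2 E W) = 1 − E min(W, W′)/E W`
(Arnold, *Pareto Distributions* (2015) §4.2 eqs. (4.2.8)–(4.2.9), crediting Arnold–Laguna 1977 and
Dorfman 1979) [corpus: book:arnold2015-pareto-distributions p.141]; Liu 1996 / Kong–Liu–Wong 1994
for `ESS/N = (E w)²/E w²`.

## Content (finite state space; target `p` and model `q > 0`, both normalised; `w = p/q`)

* `one_sub_accRate_eq_half_qq_abs_weight` — **the acceptance deficit is the Gini coefficient of
  the weights under the model**: `1 − acc(p, q) = ½ · E_{q⊗q}|w − w′|` (the Gini mean difference of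
  `w` over twice its mean `E_q w = 1`); equivalently (`tvDist_prodLaw_swap_eq_half_qq_abs_weight`)
  the pair-space total variation of theory-2 IS that half mean difference.
* `qq_sq_sub_weight_eq` — `E_{q⊗q}(w − w′)² = 2(E_q w² − 1) = 2(1/ESS − 1)` (`ESS` = the Kish
  fraction `essFrac`, `= 1/E_q w²` by `essFrac_eq_inv`).
* `sq_qq_abs_weight_le`, `sq_one_sub_accRate_le_half` — Cauchy–Schwarz on the pair space:
  `(E|w − w′|)² ≤ E(w − w′)²`, hence **`(1 − acc)² ≤ (1/ESS − 1)/2`**.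
* **`one_sub_sqrt_half_le_accRate`** — `acc ≥ 1 − √((1/ESS − 1)/2)`: the ESS floor of
  `Scaling/Acceptance` (`one_sub_sqrt_le_accRate`, `acc ≥ 1 − √(1/ESS − 1)`, obtained through
  `acc ≥ 1 − 2‖p − q‖_TV`) with the deficit divided by `√2` — the triangle inequality through
  `q ⊗ q` is what the direct pair-space estimate avoids.  Instances: population `ESS/N = 0.8` forces
  `acc ≥ 0.646` (old floor `0.5`), `0.99` forces `≥ 0.928` (old `0.899`); vacuous below `ESS = 1/3`
  (old: below `1/2`).
* `mul_div_add_le_min` (`ab/(a+b) ≤ min(a,b)`), `qq_weight_harmonic_sum_eq` and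
  **`essFrac_half_le_accRate`** — `acc ≥ ESS/2` for a fully supported target: the finite-space
  twin of row 2's measure-theoretic `Exactness.meanAccept_ge_half_ESS`
  (`Exactness/IMHAcceptanceGeHalfESS`), by one more Cauchy–Schwarz step
  (`1 = (E_{q⊗q} w w′)² ≤ E[w w′/(w + w′)] · E[w w′(w + w′)] = E[w w′/(w + w′)] · 2 E_q w²`).
  The two floors cross near `ESS ≈ 0.46`; together `acc ≥ max(ESS/2, 1 − √((1/ESS − 1)/2))`.

Reading (value-free; no number of record moves, nothing is re-scored): the two training monitors a
flow trainer prints per checkpoint — a Kish ESS fraction and an equilibrium-acceptance estimate from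
the same fresh batch — are tied IN POPULATION by these floors and by no ceiling
(`Scaling/Acceptance.acceptance_blind`: acceptance is blind to reweighting quality); the
finite-batch (plug-in) versions of the same inequalities are the subject of a companion file.
NOT CLAIMED: sharpness of the constant `1/2` under the root (the classical bound
`E|W − W′| ≤ (2/√3)·σ_W`, Arnold (4.2.10) via `G = 2 cov(W, F(W))/E W`, would give `1/3`; not
typed here); any statement out of equilibrium; any number for a trained network.

Elementary (`[folklore]`-level); farm `lean check` rc 0, no `sorry`.
-/

namespace Summit.Ventures.LatticeQCDFlow.Theory2

open Finset
open Literature.Probability.MarkovChains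
open Summit.Ventures.LatticeQCDFlow.Exactness

variable {X : Type*} [Fintype X]

/-! ### Moments of the weights under the model -/

/-- `E_q[w²] = 1/ESS` for a normalised target and a positive model (`essFrac_eq_inv` read through
`q·w² = p·w`). [folklore] -/
theorem sum_mul_weight_sq_eq_inv_essFrac {p q : X → ℝ} (hq : ∀ x, 0 < q x) (hp1 : ∑ x, p x = 1) :
    ∑ x, q x * weight p q x ^ 2 = (essFrac p q)⁻¹ := by
  rw [essFrac_eq_inv hq hp1, inv_inv]
  exact sum_congr rfl fun x _ => mul_weight_sq (hq x).ne'

/-- **Second moment of the weight difference of two independent proposals**: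
`E_{q⊗q}(w − w′)² = 2·(1/ESS − 1)` (`= 2·Var_q w = 2·χ²(p‖q)`). [folklore] -/
theorem qq_sq_sub_weight_eq {p q : X → ℝ} (hq : ∀ x, 0 < q x) (hp1 : ∑ x, p x = 1)
    (hq1 : ∑ x, q x = 1) :
    ∑ x, ∑ y, q x * q y * (weight p q x - weight p q y) ^ 2 = 2 * ((essFrac p q)⁻¹ - 1) := by
  have hS1 : ∑ x, q x * weight p q x = 1 := sum_mul_weight hq hp1
  have hS2 : ∑ x, q x * weight p q x ^ 2 = (essFrac p q)⁻¹ :=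
    sum_mul_weight_sq_eq_inv_essFrac hq hp1
  have hinner : ∀ x, ∑ y, q x * q y * (weight p q x - weight p q y) ^ 2
      = q x * weight p q x ^ 2 - 2 * (q x * weight p q x) + q x * (essFrac p q)⁻¹ := by
    intro x
    have h : ∀ y, q x * q y * (weight p q x - weight p q y) ^ 2
        = q x * weight p q x ^ 2 * q y - 2 * (q x * weight p q x) * (q y * weight p q y)
          + q x * (q y * weight p q y ^ 2) := fun y => by ring
    simp_rw [h]
    rw [sum_add_distrib, sum_sub_distrib, ← mul_sum, ← mul_sum, ← mul_sum, hq1, hS1, hS2]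
    ring
  simp_rw [hinner]
  rw [sum_add_distrib, sum_sub_distrib, ← mul_sum, ← sum_mul, hS1, hq1, hS2]
  ring

/-! ### The acceptance deficit is the Gini coefficient of the weights -/

/-- **`1 − acc(p, q) = ½ · E_{q⊗q}|w − w′|`** — the stationary independence-Metropolis acceptance
DEFICIT is the Gini coefficient (half the mean absolute difference over the mean, here `E_q w = 1`)
of the importance weights of two independent proposals.  From row 11's
`acc = E_{q⊗q}[min(w, w′)]` and `min(a, b) = (a + b − |a − b|)/2`. -/
theorem one_sub_accRate_eq_half_qq_abs_weight {p q : X → ℝ} (hq : ∀ x, 0 < q x)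
    (hp1 : ∑ x, p x = 1) (hq1 : ∑ x, q x = 1) :
    1 - accRate p q = (∑ x, ∑ y, q x * q y * |weight p q x - weight p q y|) / 2 := by
  have hS1 : ∑ x, q x * weight p q x = 1 := sum_mul_weight hq hp1
  -- the mean of `(w + w′)/2` over `q ⊗ q` is `1`
  have hmean : ∑ x, ∑ y, q x * q y * (weight p q x + weight p q y) = 2 := by
    have hinner : ∀ x, ∑ y, q x * q y * (weight p q x + weight p q y)
        = q x * weight p q x + q x := by
      intro x
      have h : ∀ y, q x * q y * (weight p q x + weight p q y)
          = q x * weight p q x * q y + q x * (q y * weight p q y) := fun y => by ring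
      simp_rw [h]
      rw [sum_add_distrib, ← mul_sum, ← mul_sum, hq1, hS1]
      ring
    simp_rw [hinner]
    rw [sum_add_distrib, hS1, hq1]
    norm_num
  -- termwise `min = (sum − |difference|)/2`
  have key : ∀ x y, q x * q y * min (weight p q x) (weight p q y)
      = q x * q y * (weight p q x + weight p q y) / 2
        - q x * q y * |weight p q x - weight p q y| / 2 := by
    intro x y
    rcases le_total (weight p q x) (weight p q y) with h | h
    · rw [min_eq_left h, abs_of_nonpos (sub_nonpos.2 h)]; ring
    · rw [min_eq_right h, abs_of_nonneg (sub_nonneg.2 h)]; ring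
  have hsplit : ∑ x, ∑ y, q x * q y * min (weight p q x) (weight p q y)
      = (∑ x, ∑ y, q x * q y * (weight p q x + weight p q y)) / 2
        - (∑ x, ∑ y, q x * q y * |weight p q x - weight p q y|) / 2 := by
    rw [sum_div, sum_div, ← sum_sub_distrib]
    refine sum_congr rfl fun x _ => ?_
    rw [sum_div, sum_div, ← sum_sub_distrib]
    exact sum_congr rfl fun y _ => key x y
  rw [Scoring.accRate_eq_qq_min_weight hq, hsplit, hmean]
  ring

/-- **The pair-space total variation of theory-2 IS the half Gini mean difference**:
`‖p⊗q − q⊗p‖_TV = ½ · E_{q⊗q}|w − w′|` (combine `accRate_eq_one_sub_tvDist_prodLaw` with the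
previous identity). [folklore] -/
theorem tvDist_prodLaw_swap_eq_half_qq_abs_weight {p q : X → ℝ} (hq : ∀ x, 0 < q x)
    (hp1 : ∑ x, p x = 1) (hq1 : ∑ x, q x = 1) :
    tvDist (prodLaw p q) (prodLaw q p)
      = (∑ x, ∑ y, q x * q y * |weight p q x - weight p q y|) / 2 := by
  have h1 := accRate_eq_one_sub_tvDist_prodLaw (p := p) (q := q) hp1 hq1
  have h2 := one_sub_accRate_eq_half_qq_abs_weight hq hp1 hq1
  linarith

/-- The Gini mean difference of the weights is non-negative. [folklore] -/
theorem qq_abs_weight_nonneg (p q : X → ℝ) (hq : ∀ x, 0 < q x) :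
    0 ≤ ∑ x, ∑ y, q x * q y * |weight p q x - weight p q y| :=
  sum_nonneg fun x _ => sum_nonneg fun y _ =>
    mul_nonneg (mul_nonneg (hq x).le (hq y).le) (abs_nonneg _)

/-! ### Cauchy–Schwarz: the Gini deficit is controlled by the ESS -/

/-- **`(E_{q⊗q}|w − w′|)² ≤ E_{q⊗q}(w − w′)² = 2(1/ESS − 1)`** (Cauchy–Schwarz with the pair weights
`q_x q_y`, in Sedrakyan's form so that no square root appears). [folklore] -/
theorem sq_qq_abs_weight_le {p q : X → ℝ} (hq : ∀ x, 0 < q x) (hp1 : ∑ x, p x = 1)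
    (hq1 : ∑ x, q x = 1) :
    (∑ x, ∑ y, q x * q y * |weight p q x - weight p q y|) ^ 2 ≤ 2 * ((essFrac p q)⁻¹ - 1) := by
  -- Sedrakyan on the pair type with numerators `q q |Δw|` and denominators `q q`
  have hS := Finset.sq_sum_div_le_sum_sq_div (Finset.univ : Finset (X × X))
    (fun z => q z.1 * q z.2 * |weight p q z.1 - weight p q z.2|)
    (g := fun z => q z.1 * q z.2) (fun z _ => mul_pos (hq z.1) (hq z.2))
  have hg : ∑ z : X × X, q z.1 * q z.2 = 1 := by
    rw [Fintype.sum_prod_type, ← sum_mul_sum, hq1, one_mul]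
  have hnum : ∑ z : X × X, q z.1 * q z.2 * |weight p q z.1 - weight p q z.2|
      = ∑ x, ∑ y, q x * q y * |weight p q x - weight p q y| := by
    rw [Fintype.sum_prod_type]
  have hrhs : ∑ z : X × X, (q z.1 * q z.2 * |weight p q z.1 - weight p q z.2|) ^ 2 / (q z.1 * q z.2)
      = ∑ x, ∑ y, q x * q y * (weight p q x - weight p q y) ^ 2 := by
    rw [Fintype.sum_prod_type]
    refine sum_congr rfl fun x _ => sum_congr rfl fun y _ => ?_
    have hx : q x ≠ 0 := (hq x).ne'
    have hy : q y ≠ 0 := (hq y).ne'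
    rw [div_eq_iff (mul_ne_zero hx hy), mul_pow, sq_abs]
    ring
  rw [hg, div_one, hnum, hrhs, qq_sq_sub_weight_eq hq hp1 hq1] at hS
  exact hS

/-- **`(1 − acc)² ≤ (1/ESS − 1)/2`.** -/
theorem sq_one_sub_accRate_le_half {p q : X → ℝ} (hq : ∀ x, 0 < q x) (hp1 : ∑ x, p x = 1)
    (hq1 : ∑ x, q x = 1) : (1 - accRate p q) ^ 2 ≤ ((essFrac p q)⁻¹ - 1) / 2 := by
  rw [one_sub_accRate_eq_half_qq_abs_weight hq hp1 hq1, div_pow]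
  have h := sq_qq_abs_weight_le hq hp1 hq1
  linarith

/-- **ESS floors acceptance, √2 sharper: `acc ≥ 1 − √((1/ESS − 1)/2)`** — compare
`Scaling/Acceptance.one_sub_sqrt_le_accRate` (`acc ≥ 1 − √(1/ESS − 1)`).  Population `ESS/N = 0.8`
forces `acc ≥ 0.646`, `0.99` forces `acc ≥ 0.928`; vacuous below `ESS = 1/3`. -/
theorem one_sub_sqrt_half_le_accRate {p q : X → ℝ} (hq : ∀ x, 0 < q x) (hp1 : ∑ x, p x = 1)
    (hq1 : ∑ x, q x = 1) :
    1 - Real.sqrt (((essFrac p q)⁻¹ - 1) / 2) ≤ accRate p q := by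
  have h1 : 1 - accRate p q ≤ Real.sqrt ((1 - accRate p q) ^ 2) := by
    rw [Real.sqrt_sq_eq_abs]; exact le_abs_self _
  have h2 : Real.sqrt ((1 - accRate p q) ^ 2) ≤ Real.sqrt (((essFrac p q)⁻¹ - 1) / 2) :=
    Real.sqrt_le_sqrt (sq_one_sub_accRate_le_half hq hp1 hq1)
  linarith

/-- The new floor dominates the old one: `1 − √(1/ESS − 1) ≤ 1 − √((1/ESS − 1)/2)` whenever
`ESS ≤ 1` (which `essFrac_le_one` guarantees). [folklore] -/
theorem one_sub_sqrt_le_one_sub_sqrt_half {p q : X → ℝ} (hq : ∀ x, 0 < q x) (hp1 : ∑ x, p x = 1)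
    (hq1 : ∑ x, q x = 1) :
    1 - Real.sqrt ((essFrac p q)⁻¹ - 1) ≤ 1 - Real.sqrt (((essFrac p q)⁻¹ - 1) / 2) := by
  have h0 : 0 ≤ (essFrac p q)⁻¹ - 1 := by
    have hsq := sq_two_mul_tvDist_le hq hp1 hq1
    nlinarith [sq_nonneg (2 * tvDist p q)]
  have h : Real.sqrt (((essFrac p q)⁻¹ - 1) / 2) ≤ Real.sqrt ((essFrac p q)⁻¹ - 1) :=
    Real.sqrt_le_sqrt (by linarith)
  linarith

/-! ### The harmonic floor: `acc ≥ ESS/2` on a finite space -/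

/-- `a·b/(a + b) ≤ min(a, b)` for `a, b > 0` (half the harmonic mean is below the minimum).
[folklore] -/
theorem mul_div_add_le_min {a b : ℝ} (ha : 0 < a) (hb : 0 < b) : a * b / (a + b) ≤ min a b := by
  rw [div_le_iff₀ (add_pos ha hb)]
  rcases le_total a b with h | h
  · rw [min_eq_left h]; nlinarith
  · rw [min_eq_right h]; nlinarith

/-- `E_{q⊗q}[w w′ (w + w′)] = 2 · E_q[w²] · E_q[w] = 2/ESS`. [folklore] -/
theorem qq_weight_harmonic_sum_eq {p q : X → ℝ} (hq : ∀ x, 0 < q x) (hp1 : ∑ x, p x = 1) :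
    ∑ x, ∑ y, q x * q y * (weight p q x * weight p q y * (weight p q x + weight p q y))
      = 2 * (essFrac p q)⁻¹ := by
  have hS1 : ∑ x, q x * weight p q x = 1 := sum_mul_weight hq hp1
  have hS2 : ∑ x, q x * weight p q x ^ 2 = (essFrac p q)⁻¹ :=
    sum_mul_weight_sq_eq_inv_essFrac hq hp1
  have hinner : ∀ x, ∑ y, q x * q y * (weight p q x * weight p q y * (weight p q x + weight p q y))
      = q x * weight p q x ^ 2 + q x * weight p q x * (essFrac p q)⁻¹ := by
    intro x
    have h : ∀ y, q x * q y * (weight p q x * weight p q y * (weight p q x + weight p q y))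
        = q x * weight p q x ^ 2 * (q y * weight p q y)
          + q x * weight p q x * (q y * weight p q y ^ 2) := fun y => by ring
    simp_rw [h]
    rw [sum_add_distrib, ← mul_sum, ← mul_sum, hS1, hS2, mul_one]
  simp_rw [hinner]
  rw [sum_add_distrib, ← sum_mul, hS1, hS2]
  ring

/-- **`acc ≥ ESS/2` on a finite space** (fully supported target and model, the target normalised;
the model's normalisation is not even needed): the finite twin of row 2's
`Exactness.meanAccept_ge_half_ESS`.  Proof: `min(w, w′) ≥ w w′/(w + w′)`
termwise, then Cauchy–Schwarz `1 = (E w w′)² ≤ E[w w′/(w + w′)] · E[w w′ (w + w′)]` with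
`E[w w′(w + w′)] = 2/ESS`. -/
theorem essFrac_half_le_accRate {p q : X → ℝ} (hp : ∀ x, 0 < p x) (hq : ∀ x, 0 < q x)
    (hp1 : ∑ x, p x = 1) : essFrac p q / 2 ≤ accRate p q := by
  have hw : ∀ x, 0 < weight p q x := fun x => div_pos (hp x) (hq x)
  have hS1 : ∑ x, q x * weight p q x = 1 := sum_mul_weight hq hp1
  have hpos : ∀ z : X × X, 0 < q z.1 * q z.2 *
      (weight p q z.1 * weight p q z.2 * (weight p q z.1 + weight p q z.2)) := fun z =>
    mul_pos (mul_pos (hq z.1) (hq z.2))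
      (mul_pos (mul_pos (hw z.1) (hw z.2)) (add_pos (hw z.1) (hw z.2)))
  -- Sedrakyan on the pair type: numerators `q q w w′`, denominators `q q w w′ (w + w′)`
  have hS := Finset.sq_sum_div_le_sum_sq_div (Finset.univ : Finset (X × X))
    (fun z => q z.1 * q z.2 * (weight p q z.1 * weight p q z.2))
    (g := fun z => q z.1 * q z.2 * (weight p q z.1 * weight p q z.2 * (weight p q z.1 + weight p q z.2)))
    (fun z _ => hpos z)
  have hnum : ∑ z : X × X, q z.1 * q z.2 * (weight p q z.1 * weight p q z.2) = 1 := by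
    rw [Fintype.sum_prod_type]
    dsimp only
    have h : ∀ x y, q x * q y * (weight p q x * weight p q y)
        = q x * weight p q x * (q y * weight p q y) := fun x y => by ring
    simp_rw [h]
    rw [← sum_mul_sum, hS1, one_mul]
  have hden : ∑ z : X × X, q z.1 * q z.2 *
      (weight p q z.1 * weight p q z.2 * (weight p q z.1 + weight p q z.2)) = 2 * (essFrac p q)⁻¹ := by
    rw [Fintype.sum_prod_type]
    exact qq_weight_harmonic_sum_eq hq hp1
  have hrhs : ∑ z : X × X, (q z.1 * q z.2 * (weight p q z.1 * weight p q z.2)) ^ 2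
        / (q z.1 * q z.2 * (weight p q z.1 * weight p q z.2 * (weight p q z.1 + weight p q z.2)))
      = ∑ x, ∑ y, q x * q y *
          (weight p q x * weight p q y / (weight p q x + weight p q y)) := by
    rw [Fintype.sum_prod_type]
    refine sum_congr rfl fun x _ => sum_congr rfl fun y _ => ?_
    have hx : q x ≠ 0 := (hq x).ne'
    have hy : q y ≠ 0 := (hq y).ne'
    have hwx : weight p q x ≠ 0 := (hw x).ne'
    have hwy : weight p q y ≠ 0 := (hw y).ne'
    have hs : weight p q x + weight p q y ≠ 0 := (add_pos (hw x) (hw y)).ne'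
    field_simp
  rw [hnum, hden, hrhs, one_pow] at hS
  have he : 0 < essFrac p q := by
    have hne : (Finset.univ : Finset X).Nonempty := by
      by_contra h
      rw [Finset.not_nonempty_iff_eq_empty] at h
      have : ∑ x, p x = 0 := by rw [h, sum_empty]
      linarith
    rw [essFrac_eq_inv hq hp1]
    exact inv_pos.2 (sum_pos (fun x _ => mul_pos (hp x) (hw x)) hne)
  have hstep : essFrac p q / 2 = 1 / (2 * (essFrac p q)⁻¹) := by
    field_simp
  rw [hstep]
  refine hS.trans ?_
  rw [Scoring.accRate_eq_qq_min_weight hq]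
  exact sum_le_sum fun x _ => sum_le_sum fun y _ =>
    mul_le_mul_of_nonneg_left (mul_div_add_le_min (hw x) (hw y)) (mul_nonneg (hq x).le (hq y).le)

/-- **Both floors at once**: `max(ESS/2, 1 − √((1/ESS − 1)/2)) ≤ acc`. -/
theorem max_essFrac_half_one_sub_sqrt_half_le_accRate {p q : X → ℝ} (hp : ∀ x, 0 < p x)
    (hq : ∀ x, 0 < q x) (hp1 : ∑ x, p x = 1) (hq1 : ∑ x, q x = 1) :
    max (essFrac p q / 2) (1 - Real.sqrt (((essFrac p q)⁻¹ - 1) / 2)) ≤ accRate p q :=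
  max_le (essFrac_half_le_accRate hp hq hp1) (one_sub_sqrt_half_le_accRate hq hp1 hq1)

end Summit.Ventures.LatticeQCDFlow.Theory2
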